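import Summits.FinalStateConjecture.FinalStateConjecture.Theorems.NearExtremalKappaCapture.Negative.SubextremalRedundancy
import Summits.FinalStateConjecture.FinalStateConjecture.Theorems.PhaseMixingCaptureNonlinearKappaUpgradeReductions

/-!
# Transfer stubs of the shape `P → KappaExplicitWaveDecay → (crux without the sub-extremality conjunct)`
# are the route's support item `NonlinearKappaUpgrade` under the extra hypothesis `P`
# (crux stmt-FinalStateConjecture-10606, line `unit-temperature-front-face`, lead c3 bookkeeping)

The registered hardest stub of line `unit-temperature-front-face`
(`Cruxes/NearExtremalKappaCapture/Lines/unit_temperature_front_face.lean`, `stub_captureTransfer`, S4)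
has the shape

    (S3-output) → KappaExplicitWaveDecay →
      ∀ [Kerr.Facts] [Kerr.SliceFacts], ∃ (s δ k γ p a₁), a₁ < 1 ∧ CaptureWithoutSub s δ k γ p a₁,

where the consequent is the crux body with the conjunct `Kerr.IsSubextremal M' a'` deleted
(`Negative.CaptureWithoutSub`), equivalent to the crux by the landed `Negative.near_iff_withoutSub`
(p74448). This file records, sorry-free and for an ARBITRARY antecedent `P : Prop` (so that it applies
to S4 as registered, to its weighted reshape S4ʷ of `Lines/unit_temperature_front_face_weighted.lean`,
and to any future transfer stub of this shape):

* `transfer_iff_imp_nonlinearKappaUpgrade` — such a stub is LITERALLY `P → NonlinearKappaUpgrade`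
  (route support item stmt-FinalStateConjecture-14714, `KappaExplicitWaveDecay → NearExtremalKappaCapture`);
* `transfer_iff_imp_near_or_not_kappa` — classically `P → (NearExtremalKappaCapture ∨ ¬ KappaExplicitWaveDecay)`
  (with the landed `NonlinearKappaUpgrade.nonlinearKappaUpgrade_iff_near_or_not_kappa`, p89152);
* `transfer_of_near`, `near_of_transfer` — the crux implies every such stub outright, and the stub
  returns the crux exactly when BOTH its antecedent `P` and the linear floor are supplied.

Consequence for the line (lead c3 verdict, `Cruxes/…/PICKED.md`): whatever the finite-time stub S3
outputs as `P`, the transfer stub is the open glue item 14714 weakened by `P`; it reduces the crux only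
in so far as `P` does, and `P` = anchored closeness on `0 < t* ≤ T/κ` is time-translation-covariant
information about a stationary background (the late leaf `{t* = T/κ, r > M}` with its induced data is
again a near-Kerr datum on `Kerr.slice a M`), so capture from thermal time on is an instance of the
crux itself. Pure logic over landed equivalences; no named fact is used.
-/

noncomputable section

set_option linter.dupNamespace false

namespace Summit.FinalStateConjecture.FinalStateConjecture.Theorems.NearExtremalKappaCapture.UnitTemperatureFrontFace

open Summit.FinalStateConjecture.FinalStateConjecture.Theses.PhaseMixingCapture
open Summit.FinalStateConjecture.FinalStateConjecture.Theorems.NearExtremalKappaCapture.Negative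
open Literature.Geometry.Lorentzian

/-- **A transfer stub of shape `P → K → (crux without Sub)` is `P → NonlinearKappaUpgrade`.** For every
antecedent `P`, `(P → KappaExplicitWaveDecay → ∀ [..], ∃ exps, a₁ < 1 ∧ CaptureWithoutSub …)` is
equivalent to `P → NonlinearKappaUpgrade`, by `Negative.near_iff_withoutSub` and `Iff.rfl` for the glue
item. In particular the registered S4 `stub_captureTransfer` of line `unit-temperature-front-face` is the
route's support item stmt-FinalStateConjecture-14714 under the extra hypothesis "S3-output". -/
theorem transfer_iff_imp_nonlinearKappaUpgrade : ∀ P : Prop,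
    (P → KappaExplicitWaveDecay →
        ∀ [Kerr.Facts] [Kerr.SliceFacts], ∃ (s : ℕ) (δ : ℝ) (k : ℕ) (γ p a₁ : ℝ),
          a₁ < 1 ∧ CaptureWithoutSub s δ k γ p a₁) ↔
      (P → NonlinearKappaUpgrade) := by
  intro P
  constructor
  · intro h hP hK
    exact near_iff_withoutSub.2 (h hP hK)
  · intro h hP hK
    exact near_iff_withoutSub.1 (h hP hK)

/-- **Classical reading.** For every antecedent `P`, a transfer stub of that shape is equivalent to
`P → (NearExtremalKappaCapture ∨ ¬ KappaExplicitWaveDecay)`: it is provable iff, granted `P`, either the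
crux is proved or the route's deciding linear crux is refuted (the route's kill fork). -/
theorem transfer_iff_imp_near_or_not_kappa (P : Prop) :
    (P → KappaExplicitWaveDecay →
        ∀ [Kerr.Facts] [Kerr.SliceFacts], ∃ (s : ℕ) (δ : ℝ) (k : ℕ) (γ p a₁ : ℝ),
          a₁ < 1 ∧ CaptureWithoutSub s δ k γ p a₁) ↔
      (P → NearExtremalKappaCapture ∨ ¬ KappaExplicitWaveDecay) := by
  rw [transfer_iff_imp_nonlinearKappaUpgrade,
    NonlinearKappaUpgrade.nonlinearKappaUpgrade_iff_near_or_not_kappa]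

/-- The crux implies every transfer stub of that shape outright (both antecedents unused). -/
theorem transfer_of_near (P : Prop) (hN : NearExtremalKappaCapture) :
    P → KappaExplicitWaveDecay →
      ∀ [Kerr.Facts] [Kerr.SliceFacts], ∃ (s : ℕ) (δ : ℝ) (k : ℕ) (γ p a₁ : ℝ),
        a₁ < 1 ∧ CaptureWithoutSub s δ k γ p a₁ :=
  (transfer_iff_imp_nonlinearKappaUpgrade P).2
    fun _ ↦ NonlinearKappaUpgrade.nonlinearKappaUpgrade_of_near hN

/-- Conversely a transfer stub of that shape returns the crux exactly when its antecedent `P` AND the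
linear floor are both supplied — the composition `NearExtremalKappaCapture_of_linearFloor` of the line. -/
theorem near_of_transfer (P : Prop)
    (h : P → KappaExplicitWaveDecay →
      ∀ [Kerr.Facts] [Kerr.SliceFacts], ∃ (s : ℕ) (δ : ℝ) (k : ℕ) (γ p a₁ : ℝ),
        a₁ < 1 ∧ CaptureWithoutSub s δ k γ p a₁)
    (hP : P) (hK : KappaExplicitWaveDecay) : NearExtremalKappaCapture :=
  (transfer_iff_imp_nonlinearKappaUpgrade P).1 h hP hK

end Summit.FinalStateConjecture.FinalStateConjecture.Theorems.NearExtremalKappaCapture.UnitTemperatureFrontFace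

end
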